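import Summits.QuantumFields.YangMills.Theorems.BalabanUVNodesN15PerCubeGreenKnitClose
import Summits.QuantumFields.YangMills.Theorems.BalabanUVNodesN15PerCubeGreenJetCubesUNClose
import Summits.QuantumFields.YangMills.Theorems.BalabanUVNodesN15PerCubeGreenJetKnitCloseSmall
import HarnessLib

/-!
# N15 = NE2, road (c) — PROGRAMME (PC), towards (PC-D) «the per-cube LANDAU LETTER»: WALK LOCALITY WITH CLOSE NEAR DATA OF A LEFT FACTOR THROUGH THE SCALAR COVARIANT GREEN's-
# FUNCTION KNIT AT THE COVER — two families of per-cube gauge data agreeing off `Far` and TWO LEFT FACTORS of displayed covariance give knits `D∘𝒢`, `D♭∘𝒢♭` differing by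
# `B·[(c_s(1 + r_Pc_R) + c_d)(r_V(1+|J⊕J|) + R_N + (L^m)⁻¹ + θ_F + e^{−(3δ∕128)d_Z(y)}) + c_sr_P]·e^{−(δ∕64)d}` (dag-n15-c g29, n15-c∕303)

Cell `pub-ymgap`, seat `pub-ymgap-dag-n15-c` (generation g29; R134 (a), s1; HUMAN RULING D-0062).  `bears_on: R4∕N15 · K3⁸ SpineGivenEndpointR13SepCoPHV (stmt-QuantumFields-27366)`;
filed `--kind proof --supports stmt-QuantumFields-27366 --as helper` — COUNT-NEUTRAL.  One theorem; 0 `def`, 0 `sorry`.  GENERATED from the TREE text of n15-c∕295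
`…PerCubeGreenKnitClose` (`uN_scGlued_sub_scGlued_spec`: its cover bookkeeping VERBATIM) with n15-c∕273's jet binder block twice; the capstone is n15-c∕302
`uN_hasMaj_comp_glueInv_sub_smoothCutDressed_localGauges_close`, the final arithmetic n15-c∕303a `closeMajJet_le`.  Imports 295, 302, 303a BY NAME.  Nothing in the tree is
modified, no landed name re-declared.

WHY ((PC-D), HOME `PCD-DESIGN-g28.md`).  n15-c∕296 turned n15-c∕295 into `G′(V) − G′(𝟙) ≤ (Σ + e^{−cd_Z(y)})Be^{−δd}` for `V` in the class (3.35) near a cube; the per-cube Landau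
letter needs the same for the gradient entry, `D_VG′(V) − ∂G′(𝟙)`, and a derivative of 296's row costs `n`.  THIS FILE is the site knit with the two left factors carried through
(n15-c∕300–302): the next file takes `D := D_{V,μ}`, `D♭ := ∂_μ = D_{𝟙,μ}` (covariance n15-c∕270, species parts `≤ r_V` under the cut, `= 0` for the flat family) and identifies both
knits with the named Green's functions (n15-c∕266).

WHAT.  ★★★ `uN_comp_scGlued_sub_spec`: n15-c∕295's binder list (two families `(u, U, P, N_V)`, `(u♭, U♭, P♭, N♭_V)` with the same letters `r_V, R_N, θ_F`, `u♭ = u` off `Far`,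
`S_k ⊆ Z` on `Far`) + n15-c∕273's jet block for each family (`D`, `v_k`, `P^sp_k ≤ 1_{S_k}r_Pe^{−δd}`, `P^far_k M_{χ_k} = 0`, Leibniz letters `c_s, c_d`; `v♭ = v` off `Far`) ⟹
`HasMaj (D∘scGlued(u,U,P,N_V) − D♭∘scGlued(u♭,U♭,P♭,N♭_V)) (B·[(c_s(1 + r_Pc_R) + c_d)(r_V(1+|J⊕J|) + R_N + (L^m)⁻¹ + θ_F + e^{−(3δ∕128)d_Z(y)}) + c_sr_P]·e^{−(δ∕64)d})` with
constants depending on `(d, L, a₀, |ι|)` only.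

HONEST FRAMING ∕ LIMITS.  MODEL carriers (King's ∕ dag-n15-a's coloured scalars on the doubled unit torus, the cover of n15-c∕260); composition of LANDED theorems; [B9] (3.34)–(3.35)
p.396, (3.42) p.397, Cor. 3.8 p.410, Thm 3.14 pp.426–427 cited for SHAPES ∕ MECHANISM, not for printed statements.  NE2⁺ NOT PRINTED, NOT proved; N15 of record untouched (DISCHARGED
AS CONSUMED, p687738); K3⁸ OPEN; counts of record UNMOVED; one finite 𝕋⁴ at fixed ε per index — NOT infinite volume, NOT OS on ℝ⁴, NOT a mass gap, NOT Clay.  Restate-immune.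
-/

noncomputable section

open scoped BigOperators Matrix Matrix.Norms.Frobenius

namespace Summit.QuantumFields.YangMills.BalabanUVNodes.N15.Gluing

open Real
open Literature.MathematicalPhysics.QuantumFieldTheory.Balaban1983to89
open Literature.MathematicalPhysics.QuantumFieldTheory.Balaban1983to89.B5Prop11Plancherel (Tor fine unitVec)
open Literature.MathematicalPhysics.QuantumFieldTheory.Balaban1983to89.B11SectG (BlockNorm HasMaj RowSum hasMaj_zero)
open Literature.MathematicalPhysics.QuantumFieldTheory.Balaban1983to89.B6RandomWalk (Triangle254)
open Literature.MathematicalPhysics.QuantumFieldTheory.Balaban1983to89.B6Prop26Gluing (mulOp mulOp_apply ind ind_nonneg ind_le_one)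
open Literature.MathematicalPhysics.QuantumFieldTheory.Balaban1983to89.B6UnitTorusCarrier (unitTorusGeo triangle254_unitTorusGeo rowSum_unitTorusGeo unitTorusGeo_dist_nonneg
  unitTorusGeo_dist_symm unitTorusGeo_dist_self)
open Literature.MathematicalPhysics.QuantumFieldTheory.Balaban1983to89.B5SiteBridgeP12 (MP)
open Literature.MathematicalPhysics.QuantumFieldTheory.King1986 (aK aK_pos aK_le)
open Literature.MathematicalPhysics.QuantumFieldTheory.King1986.Torus (blockOf tdistT tdistT_nonneg tdistT_symm)
open Literature.Barriers.QuantumFields (traceForm)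
open Summit.QuantumFields.YangMills.BalabanUVNodes.N15.BackgroundLayer (fgrad fgradAdj bgrad fgrad_apply fgradAdj_apply bgrad_apply stack projO bgPropV covLapM tCoefA tCoefC unstackM)
open Summit.QuantumFields.YangMills.BalabanUVNodes.N15.VectorPiece (bshiftEquiv bshiftEquiv_apply tensorId tdistT_blockOf_sub_unitVec_le)
open Summit.QuantumFields.YangMills.BalabanUVNodes.N15.MatrixSpecies (mmulOp coordMat liftBlk liftEquiv liftEquiv_apply liftEquiv_symm_apply)
open Summit.QuantumFields.YangMills.BalabanUVNodes.N15.TwoGrid (paramsOf chiCube cubeBlocks chiCube_of_not_mem abs_chiCube_le_one)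
open Summit.QuantumFields.YangMills.BalabanUVNodes.N15.CurvedSpecies (gaugePair uN_hasMaj_comp_glueInv_sub_smoothCutDressed_localGauges_close)
open Summit.QuantumFields.YangMills.BalabanUVNodes.N15.CovLandau (cgrad csavg cGreen bBack flatRowsAll_king)

variable {d : ℕ}

/-! ## §2 The knit at the cover: walk locality under a change of the gauge data away from the arguments -/

section Knit

variable {L : ℕ} [NeZero L]

set_option maxHeartbeats 800000 in
set_option maxRecDepth 2048 in
/-- ★★★ **WALK LOCALITY OF A LEFT FACTOR THROUGH THE SCALAR COVARIANT GREEN's-FUNCTION KNIT AT THE COVER, CLOSE NEAR DATA**: for `(d, L, a₀, ι)` there are `δ, w₀, R₀, θ₀, B, c_R`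
such that at every index `(m, k)` with `L^m ≥ w₀`, for every far predicate `Far`, zone `Z ⊇ ⋃_{Far k} S_k` with a distance minorant `d_Z`, two families of unitary per-cube site gauges,
bond variables, nonlocal summands and perturbations `(u, U, P, N_V)`, `(u♭, U♭, P♭, N♭_V)` with n15-c∕262's letters (`r_V(1+|J⊕J|) + R_N ≤ R₀`, `θ_F ≤ θ₀`), `u♭ = u` off `Far`, and two
left factors `D`, `D♭` with n15-c∕273's displayed covariances in the respective gauges (orthogonal families `v`, `v♭` equal off `Far`, species parts `≤ 1_{S_k}r_Pe^{−δd}`, far parts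
killed by the cut, Leibniz letters `c_s, c_d`): `D∘𝒢 − D♭∘𝒢♭ ≤ B·[(c_s(1 + r_Pc_R) + c_d)(r_V(1+|J⊕J|) + R_N + (L^m)⁻¹ + θ_F + e^{−(3δ∕128)d_Z(y)}) + c_sr_P]·e^{−(δ∕64)d}`.
[cite: Balaban1985BackgroundPropagators, (3.34)–(3.35) p.396, (3.42) p.397 (gradient entries: shape), Cor. 3.8 p.410, Thm 3.14 pp.426–427 (mechanism); Balaban1984PropagatorsII, (2.91)–(2.93) p.239, (2.133)–(2.136) p.247; King1986, Thm 2.1 (2.4) p.20] -/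
theorem uN_comp_scGlued_sub_spec (hL : Odd L ∧ 1 < L) (hL7 : 7 ≤ L) {a₀ : ℝ} (ha₀ : 0 < a₀) (ι : Type) [Fintype ι] [DecidableEq ι] :
    ∃ δ w₀ R₀ θ₀ B cR : ℝ, 0 < δ ∧ 0 < R₀ ∧ 0 < θ₀ ∧ 0 < B ∧ 0 ≤ cR ∧
      ∀ (mv kk : ℕ), 1 ≤ kk → w₀ ≤ ((L ^ mv : ℕ) : ℝ) →
      ∀ {mm : Type} [Fintype mm] [DecidableEq mm] (e : Matrix mm mm ℂ ≃L[ℝ] (ι → ℝ)), (∀ A B : Matrix mm mm ℂ, traceForm A B = e A ⬝ᵥ e B) →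
      ∀ (Far : (Fin (d + 1) → ZMod (2 * L)) → Prop) [DecidablePred Far] (Z : Set (Tor (cvM d L mv kk hL))) (dZ : Tor (cvM d L mv kk hL) → ℝ),
        (∀ y z, z ∈ Z → dZ y ≤ (unitTorusGeo L kk (cvM d L mv kk hL)).dist y z) → (∀ y, 0 ≤ dZ y) → (∀ k, Far k → cvSk d L mv kk hL k ⊆ Z) →
      ∀ (u u₂ : (Fin (d + 1) → ZMod (2 * L)) → ScX d L mv kk hL → Matrix mm mm ℂ), (∀ k x, (u k x)ᴴ * u k x = 1) → (∀ k x, (u₂ k x)ᴴ * u₂ k x = 1) → (∀ k, ¬Far k → u₂ k = u k) →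
      ∀ (U U₂ : Fin (d + 1) → ScX d L mv kk hL → Matrix mm mm ℂ) (P P₂ : (ScX d L mv kk hL × ι → ℝ) →ₗ[ℝ] (ScX d L mv kk hL × ι → ℝ))
        (NV NV₂ : (Fin (d + 1) → ZMod (2 * L)) → (ScX d L mv kk hL × ι → ℝ) →ₗ[ℝ] (ScX d L mv kk hL × ι → ℝ)) (rV RN θF : ℝ),
        0 ≤ rV → 0 ≤ RN → 0 ≤ θF → rV * (1 + Fintype.card (Fin (d + 1) ⊕ Fin (d + 1))) + RN ≤ R₀ → θF ≤ θ₀ →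
        (∀ k, mmulOp (fun x => coordMat e (ContinuousLinearMap.mulLeftRight ℝ (Matrix mm mm ℂ) (u k x) (u k x)ᴴ)) ∘ₗ P ∘ₗ mmulOp (fun x => (coordMat e (ContinuousLinearMap.mulLeftRight ℝ (Matrix mm mm ℂ) (u k x) (u k x)ᴴ))ᵀ) = (scQQ d L mv kk hL (aK a₀ (L : ℝ) kk * (((L ^ kk : ℕ) : ℝ)) ^ (d + 1)) ι) - NV k) →
        (∀ k x, scChi d L mv kk hL k x ≠ 0 → ∀ i, ∑ j, |tCoefC ((((L ^ kk : ℕ) : ℝ))⁻¹) (gaugePair (scShift d L mv kk hL) fun μ x => coordMat e (ContinuousLinearMap.mulLeftRight ℝ (Matrix mm mm ℂ) (u k x * U μ x * (u k (scShift d L mv kk hL μ x))ᴴ) (u k x * U μ x * (u k (scShift d L mv kk hL μ x))ᴴ)ᴴ)) x i j| ≤ rV) →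
        (∀ k j' x, scChi d L mv kk hL k x ≠ 0 → ∀ i, ∑ j, |tCoefA ((((L ^ kk : ℕ) : ℝ))⁻¹) (gaugePair (scShift d L mv kk hL) fun μ x => coordMat e (ContinuousLinearMap.mulLeftRight ℝ (Matrix mm mm ℂ) (u k x * U μ x * (u k (scShift d L mv kk hL μ x))ᴴ) (u k x * U μ x * (u k (scShift d L mv kk hL μ x))ᴴ)ᴴ)) j' x i j| ≤ rV) →
        (∀ k, HasMaj (ScNorm d L mv kk hL ι) (ScNorm d L mv kk hL ι) (mulOp (fun p : ScX d L mv kk hL × ι => scPsi d L mv kk hL k p.1) ∘ₗ NV k ∘ₗ mulOp (fun p : ScX d L mv kk hL × ι => scChi d L mv kk hL k p.1)) (fun y y' => RN * Real.exp (-(δ * (unitTorusGeo L kk (cvM d L mv kk hL)).dist y y')))) →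
        (∀ k, HasMaj (ScNorm d L mv kk hL ι) (ScNorm d L mv kk hL ι) ((LinearMap.id - mulOp (fun p : ScX d L mv kk hL × ι => scPsi d L mv kk hL k p.1)) ∘ₗ NV k ∘ₗ mulOp (fun p : ScX d L mv kk hL × ι => scChi d L mv kk hL k p.1)) (fun y y' => θF * Real.exp (-(δ * (unitTorusGeo L kk (cvM d L mv kk hL)).dist y y')))) →
        (∀ k, mmulOp (fun x => coordMat e (ContinuousLinearMap.mulLeftRight ℝ (Matrix mm mm ℂ) (u₂ k x) (u₂ k x)ᴴ)) ∘ₗ P₂ ∘ₗ mmulOp (fun x => (coordMat e (ContinuousLinearMap.mulLeftRight ℝ (Matrix mm mm ℂ) (u₂ k x) (u₂ k x)ᴴ))ᵀ) = (scQQ d L mv kk hL (aK a₀ (L : ℝ) kk * (((L ^ kk : ℕ) : ℝ)) ^ (d + 1)) ι) - NV₂ k) →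
        (∀ k x, scChi d L mv kk hL k x ≠ 0 → ∀ i, ∑ j, |tCoefC ((((L ^ kk : ℕ) : ℝ))⁻¹) (gaugePair (scShift d L mv kk hL) fun μ x => coordMat e (ContinuousLinearMap.mulLeftRight ℝ (Matrix mm mm ℂ) (u₂ k x * U₂ μ x * (u₂ k (scShift d L mv kk hL μ x))ᴴ) (u₂ k x * U₂ μ x * (u₂ k (scShift d L mv kk hL μ x))ᴴ)ᴴ)) x i j| ≤ rV) →
        (∀ k j' x, scChi d L mv kk hL k x ≠ 0 → ∀ i, ∑ j, |tCoefA ((((L ^ kk : ℕ) : ℝ))⁻¹) (gaugePair (scShift d L mv kk hL) fun μ x => coordMat e (ContinuousLinearMap.mulLeftRight ℝ (Matrix mm mm ℂ) (u₂ k x * U₂ μ x * (u₂ k (scShift d L mv kk hL μ x))ᴴ) (u₂ k x * U₂ μ x * (u₂ k (scShift d L mv kk hL μ x))ᴴ)ᴴ)) j' x i j| ≤ rV) →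
        (∀ k, HasMaj (ScNorm d L mv kk hL ι) (ScNorm d L mv kk hL ι) (mulOp (fun p : ScX d L mv kk hL × ι => scPsi d L mv kk hL k p.1) ∘ₗ NV₂ k ∘ₗ mulOp (fun p : ScX d L mv kk hL × ι => scChi d L mv kk hL k p.1)) (fun y y' => RN * Real.exp (-(δ * (unitTorusGeo L kk (cvM d L mv kk hL)).dist y y')))) →
        (∀ k, HasMaj (ScNorm d L mv kk hL ι) (ScNorm d L mv kk hL ι) ((LinearMap.id - mulOp (fun p : ScX d L mv kk hL × ι => scPsi d L mv kk hL k p.1)) ∘ₗ NV₂ k ∘ₗ mulOp (fun p : ScX d L mv kk hL × ι => scChi d L mv kk hL k p.1)) (fun y y' => θF * Real.exp (-(δ * (unitTorusGeo L kk (cvM d L mv kk hL)).dist y y')))) →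
        ∀ (jj : Fin (d + 1) ⊕ Fin (d + 1)) (Dg : (ScX d L mv kk hL × ι → ℝ) →ₗ[ℝ] (ScX d L mv kk hL × ι → ℝ)) (vg : (Fin (d + 1) → ZMod (2 * L)) → ScX d L mv kk hL → Matrix ι ι ℝ) (Psp Pfar : (Fin (d + 1) → ZMod (2 * L)) → (ScX d L mv kk hL × ι → ℝ) →ₗ[ℝ] (ScX d L mv kk hL × ι → ℝ))
          (hsX dhX : (Fin (d + 1) → ZMod (2 * L)) → ScX d L mv kk hL → ℝ) (cs cd rP : ℝ), 0 ≤ cs → 0 ≤ cd → 0 ≤ rP → (∀ k x, (vg k x)ᵀ * vg k x = 1) →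
        (∀ k, Dg ∘ₗ mmulOp (fun x => (coordMat e (ContinuousLinearMap.mulLeftRight ℝ (Matrix mm mm ℂ) (u k x) (u k x)ᴴ))ᵀ) =
            mmulOp (fun x => (vg k x)ᵀ) ∘ₗ (Sum.elim (fun μ => fgrad (((L ^ kk : ℕ) : ℝ)) (liftEquiv (scShift d L mv kk hL μ) ι))
              (fun μ => bgrad (((L ^ kk : ℕ) : ℝ)) (liftEquiv (scShift d L mv kk hL μ) ι)) jj + Psp k + Pfar k)) →
        (∀ k, Dg ∘ₗ mulOp (fun p : ScX d L mv kk hL × ι => scH d L mv kk hL k p.1) = mulOp (fun p : ScX d L mv kk hL × ι => hsX k p.1) ∘ₗ Dg + mulOp (fun p : ScX d L mv kk hL × ι => dhX k p.1)) →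
        (∀ k (p : ScX d L mv kk hL × ι), |hsX k p.1| ≤ cs) → (∀ k (p : ScX d L mv kk hL × ι), |dhX k p.1| ≤ cd) →
        (∀ k, HasMaj (ScNorm d L mv kk hL ι) (ScNorm d L mv kk hL ι) (Psp k)
            (fun y y' => ind (g := unitTorusGeo L kk (cvM d L mv kk hL)) (cvSk d L mv kk hL k) y * (rP * Real.exp (-(δ * (unitTorusGeo L kk (cvM d L mv kk hL)).dist y y'))))) →
        (∀ k, Pfar k ∘ₗ mulOp (fun p : ScX d L mv kk hL × ι => scChi d L mv kk hL k p.1) = 0) →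
        ∀ (Dg₂ : (ScX d L mv kk hL × ι → ℝ) →ₗ[ℝ] (ScX d L mv kk hL × ι → ℝ)) (vg₂ : (Fin (d + 1) → ZMod (2 * L)) → ScX d L mv kk hL → Matrix ι ι ℝ) (Psp₂ Pfar₂ : (Fin (d + 1) → ZMod (2 * L)) → (ScX d L mv kk hL × ι → ℝ) →ₗ[ℝ] (ScX d L mv kk hL × ι → ℝ)),
          (∀ k x, (vg₂ k x)ᵀ * vg₂ k x = 1) →
        (∀ k, Dg₂ ∘ₗ mmulOp (fun x => (coordMat e (ContinuousLinearMap.mulLeftRight ℝ (Matrix mm mm ℂ) (u₂ k x) (u₂ k x)ᴴ))ᵀ) = mmulOp (fun x => (vg₂ k x)ᵀ) ∘ₗ (Sum.elim (fun μ => fgrad (((L ^ kk : ℕ) : ℝ)) (liftEquiv (scShift d L mv kk hL μ) ι)) (fun μ => bgrad (((L ^ kk : ℕ) : ℝ)) (liftEquiv (scShift d L mv kk hL μ) ι)) jj + Psp₂ k + Pfar₂ k)) →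
        (∀ k, Dg₂ ∘ₗ mulOp (fun p : ScX d L mv kk hL × ι => scH d L mv kk hL k p.1) = mulOp (fun p : ScX d L mv kk hL × ι => hsX k p.1) ∘ₗ Dg₂ + mulOp (fun p : ScX d L mv kk hL × ι => dhX k p.1)) →
        (∀ k, HasMaj (ScNorm d L mv kk hL ι) (ScNorm d L mv kk hL ι) (Psp₂ k)
            (fun y y' => ind (g := unitTorusGeo L kk (cvM d L mv kk hL)) (cvSk d L mv kk hL k) y * (rP * Real.exp (-(δ * (unitTorusGeo L kk (cvM d L mv kk hL)).dist y y'))))) →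
        (∀ k, Pfar₂ k ∘ₗ mulOp (fun p : ScX d L mv kk hL × ι => scChi d L mv kk hL k p.1) = 0) → (∀ k, ¬Far k → vg₂ k = vg k) →
        HasMaj (ScNorm d L mv kk hL ι) (ScNorm d L mv kk hL ι) (Dg ∘ₗ scGlued d L mv kk hL (aK a₀ (L : ℝ) kk * (((L ^ kk : ℕ) : ℝ)) ^ (d + 1)) ((((L ^ kk : ℕ) : ℝ))⁻¹) ι e u U P NV -
            Dg₂ ∘ₗ scGlued d L mv kk hL (aK a₀ (L : ℝ) kk * (((L ^ kk : ℕ) : ℝ)) ^ (d + 1)) ((((L ^ kk : ℕ) : ℝ))⁻¹) ι e u₂ U₂ P₂ NV₂)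
          (fun y y' => B * ((cs * (1 + rP * cR) + cd) * ((rV * (1 + Fintype.card (Fin (d + 1) ⊕ Fin (d + 1))) + RN + (((L ^ mv : ℕ) : ℝ))⁻¹) + θF + Real.exp (-(3 * δ / 128 * dZ y))) + cs * rP) * Real.exp (-(δ / 64 * (unitTorusGeo L kk (cvM d L mv kk hL)).dist y y'))) := by
  have hL2 : 2 ≤ L := by omega
  have hL3 : 3 ≤ L := by omega
  have hL1r : (1 : ℝ) < (L : ℝ) := by exact_mod_cast hL.2
  obtain ⟨C, δm, hC, hδm0, H⟩ := flatRowsAll_king (d := d) L hL.1 hL2 ha₀ (γ := (1 / 4 : ℝ)) (by norm_num) (by norm_num)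
  set cr : ℝ := B4Sect5Proof.latticeConst (d + 1) (δm / 128) with hcr_def
  have hcr0 : 0 ≤ cr := B4Sect5Proof.latticeConst_nonneg (d + 1) (by positivity)
  set β : ℝ := C with hβdef
  set β₁ : ℝ := C with hβ₁def
  set Nov : ℝ := (((2 * L) ^ (d + 1) : ℕ) : ℝ) with hNovdef
  set cι2 : ℝ := (Fintype.card ι : ℝ) ^ 2 with hcι2def
  set R : ℝ := 1 / (2 * ((β + (β₁ + π * β)) * cr * cr) + 1) with hRdef
  set θ₀ : ℝ := 1 / (4 * (Nov * cr * (cι2 * (2 * (β + (β₁ + π * β))) * cr)) + 4) with hθ₀def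
  set A₁ : ℝ := (Fintype.card (Fin (d + 1)) : ℝ) * (32 * π ^ 2 * (2 * (β + (β₁ + π * β))) + 2 * (π * (2 * (β + (β₁ + π * β))))) +
    (π * ((d : ℝ) + 1) * 0 + 2 * (π * ((d : ℝ) + 1))) * a₀ * (2 * (β + (β₁ + π * β))) * cr with hA₁def
  set A₂ : ℝ := (π * ((d : ℝ) + 1) * (Real.exp 1 * (δm / 2))⁻¹ + 2 * (π * ((d : ℝ) + 1) + π * ((d : ℝ) + 1) * 1)) * R * (2 * (β + (β₁ + π * β))) * cr +
    R * π * (2 * (β + (β₁ + π * β))) * cr with hA₂def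
  set w₀ : ℝ := 4 * (Nov * cr * (cι2 * (A₁ + A₂ + 2 * 0))) + 2 with hw₀def
  set Bout : ℝ := 2 * cr * (2 * (Nov * (cι2 * ((β + (β₁ + π * β)) * ((2 * (β + (β₁ + π * β))) * cr) * cr)))) + 8 * cr * cr * (Nov * (cι2 * (2 * (β + (β₁ + π * β))))) * (Nov * cr * (cι2 * (A₁ + A₂ + 2 * 0))) + 8 * cr * cr * (Nov * (cι2 * (2 * (β + (β₁ + π * β))))) * (Nov * cr * (cι2 * ((2 * (β + (β₁ + π * β))) * cr))) + (2 * (Nov * (cι2 * (2 * (β + (β₁ + π * β))))) + Nov * (cι2 * (2 * (β + (β₁ + π * β)))) * (2 * cr)) * (2 * cr) + 1 with hBoutdef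
  have hβ0 : 0 ≤ β := hC.le
  have hβ₁0 : 0 ≤ β₁ := hC.le
  have hNov0 : 0 ≤ Nov := by positivity
  have hR0 : 0 < R := by positivity
  have hθ₀0 : 0 < θ₀ := by positivity
  have hA₁0 : 0 ≤ A₁ := by positivity
  have hA₂0 : 0 ≤ A₂ := by positivity
  refine ⟨δm, w₀, R, θ₀, Bout, cr, hδm0, hR0, hθ₀0, by positivity, hcr0, fun mv kk hk hw₀ => ?_⟩
  intro mm _ _ e he Far _ Z dZ hdZ hdZ0 hZ u u₂ hu hu₂ huu U U₂ P P₂ NV NV₂ rV RN θF hrV hRN hθF0 hRle hθle hP hCloc hAloc hNVcut hfarN hP₂ hCloc₂ hAloc₂ hNVcut₂ hfarN₂ jj Dg vg Psp Pfar hsX dhX cs cd rP hcs hcd hrP hvg' hDcov hDleib hhs hdh hPsp hPfar Dg₂ vg₂ Psp₂ Pfar₂ hvg₂' hDcov₂ hDleib₂ hPsp₂ hPfar₂ hvv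
  -- the data of the cover at `(m, k)`
  have hn : 1 ≤ L ^ kk := Nat.one_le_pow _ _ (by omega)
  have hW0 : 4 * (Nov * cr * (cι2 * (A₁ + A₂ + 2 * 0))) ≤ ((L ^ mv : ℕ) : ℝ) := by linarith only [hw₀]
  have hW2R : (2 : ℝ) ≤ ((L ^ mv : ℕ) : ℝ) := by
    have : 0 ≤ 4 * (Nov * cr * (cι2 * (A₁ + A₂ + 2 * 0))) := by positivity
    linarith only [this, hw₀]
  have hW2 : 2 ≤ L ^ mv := by exact_mod_cast hW2R
  have hw : 0 < L ^ mv := by omega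
  have hW1 : (1 : ℝ) ≤ ((L ^ mv : ℕ) : ℝ) := by linarith only [hW2R]
  have hWpos : (0 : ℝ) < ((L ^ mv : ℕ) : ℝ) := by linarith only [hW2R]
  have hM : ∀ ν, cvM d L mv kk hL ν = 2 * L * L ^ mv := MP_succ_eq L mv kk hL
  have hMc : ∀ ν, cvM d L mv kk hL ν = 2 * L ^ (mv + 1) := fun ν => rfl
  have hlo : (2 : ℝ) * ((L ^ mv : ℕ) : ℝ) ≤ ((2 * L ^ mv : ℕ) : ℝ) := by push_cast; exact le_rfl
  have hhi : ((2 * L ^ mv : ℕ) : ℝ) + ((L ^ mv : ℕ) : ℝ) + (2 + 1) * ((L ^ mv : ℕ) : ℝ) + 1 ≤ ((6 * L ^ mv + 1 : ℕ) : ℝ) := by push_cast; linarith only []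
  have hS6 : 6 * L ^ mv + 1 ≤ 2 * L * L ^ mv := by
    have h7 : 7 * L ^ mv ≤ L * L ^ mv := Nat.mul_le_mul_right _ hL7
    have e : 2 * L * L ^ mv = 2 * (L * L ^ mv) := by ring
    rw [e]; omega
  have hm₁ : 2 * L ^ mv ≤ coverMargin L mv := two_mul_le_coverMargin hL7 mv
  have hfitI : coverMargin L mv - 2 * L ^ mv + (6 * L ^ mv + 1) ≤ L * L ^ mv := coverMargin_inner_fit hL7 hW2
  have hfit0 := coverMargin_fit hL3 mv
  have hfit : coverMargin L mv + 2 * L ^ mv + 1 ≤ L * L ^ mv := by omega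
  have hS0 : L * L ^ mv ≤ 2 * L * L ^ mv := by rw [mul_assoc]; omega
  have hR2 : 1 + |(((L ^ kk : ℕ) : ℝ) * ((L ^ mv : ℕ) : ℝ))⁻¹| ≤ (2 : ℝ) := one_add_inv_le_of_two_le 2 hw le_rfl
  have hK0 : 0 < 2 * L := by omega
  have hK2 : 2 ≤ 2 * L := by omega
  set η : ℝ := (((L ^ kk : ℕ) : ℝ))⁻¹ with hη
  set W : ℝ := ((L ^ mv : ℕ) : ℝ) with hWdef
  have hηinv : η⁻¹ = ((L ^ kk : ℕ) : ℝ) := by rw [hη, inv_inv]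
  have hnr : (0 : ℝ) < ((L ^ kk : ℕ) : ℝ) := by exact_mod_cast hn
  -- the site coordinates' step and the partition letters
  have hξS := scXi_shift_lift ι hM hw (d := d) (L := L) (mv := mv) (kk := kk) (hL := hL)
  have hs0 : (0 : ℝ) ≤ ((((L ^ kk : ℕ) : ℝ)) * ((L ^ mv : ℕ) : ℝ))⁻¹ := by positivity
  have hs1 : ((((L ^ kk : ℕ) : ℝ)) * ((L ^ mv : ℕ) : ℝ))⁻¹ ≤ 1 := inv_le_one_of_one_le₀ (one_le_mul_of_one_le_of_one_le (by exact_mod_cast hn) hW1)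
  have hsW : |((L ^ kk : ℕ) : ℝ)| * (π * |((((L ^ kk : ℕ) : ℝ)) * ((L ^ mv : ℕ) : ℝ))⁻¹|) = π / W := by
    rw [abs_of_pos hnr, abs_of_nonneg hs0, mul_inv, hWdef]; field_simp
  have hsW2 : ((L ^ kk : ℕ) : ℝ) ^ 2 * (32 * π ^ 2 * (((((L ^ kk : ℕ) : ℝ)) * ((L ^ mv : ℕ) : ℝ))⁻¹) ^ 2) = 32 * π ^ 2 / W ^ 2 := by
    rw [mul_inv, hWdef]; field_simp
  -- King's window and the flat rows at the mass `a_K(a₀, L, k)·n^{d+1}`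
  have haK : 0 < aK a₀ (L : ℝ) kk := aK_pos ha₀ hL1r hk
  have haKle : aK a₀ (L : ℝ) kk ≤ a₀ := aK_le ha₀ hL1r hk
  have ha' : 0 < aK a₀ (L : ℝ) kk * (((L ^ kk : ℕ) : ℝ)) ^ (d + 1) := by positivity
  have hcNle : |aK a₀ (L : ℝ) kk * (((L ^ kk : ℕ) : ℝ)) ^ (d + 1)| * ((((L ^ kk : ℕ) : ℝ)) ^ (d + 1))⁻¹ * (2 * (π * (d + 1) / (L ^ mv : ℕ))) ≤
      (π * (d + 1) / W * 0 + 2 * (π * (d + 1) / W)) * a₀ := by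
    rw [abs_of_pos ha', mul_assoc (aK a₀ (L : ℝ) kk), mul_inv_cancel₀ (by positivity), mul_one, mul_zero, zero_add, hWdef, mul_comm]
    exact mul_le_mul_of_nonneg_left haKle (by positivity)
  obtain ⟨hG0, hGF, -, hGB, -⟩ := H kk hk 1 le_rfl (mv + 1) (cvM d L mv kk hL) hMc ι
  -- the windows of the cut box about the partition cell, radius 2
  have hwin2 : ∀ (μ : Fin (d + 1)) (k : Fin (d + 1) → ZMod (2 * L)) (p : ScX d L mv kk hL × ι),
      (∃ p₀ : ScX d L mv kk hL × ι, (p₀ = p ∨ p₀ = (fun μ => liftEquiv (scShift d L mv kk hL μ) ι) μ p ∨ p₀ = ((fun μ => liftEquiv (scShift d L mv kk hL μ) ι) μ).symm p) ∧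
        ∀ ν, |cenRep (2 * L) ((fun ν (p : ScX d L mv kk hL × ι) => scXi d L mv kk hL ν p.1) ν p₀ - ((k ν).val : ℝ))| < 2 + 1) →
      (fun p : ScX d L mv kk hL × ι => scChi d L mv kk hL k p.1) p = 1 :=
    fun μ k p hp => scChi_lift_eq_one_of_near_bbox 2 ι hM hw hlo hhi hS6 μ k p hp
  have hwin : ∀ (μ : Fin (d + 1)) (k : Fin (d + 1) → ZMod (2 * L)) (p : ScX d L mv kk hL × ι),
      (∃ p₀ : ScX d L mv kk hL × ι, (p₀ = p ∨ p₀ = (fun μ => liftEquiv (scShift d L mv kk hL μ) ι) μ p ∨ p₀ = ((fun μ => liftEquiv (scShift d L mv kk hL μ) ι) μ).symm p) ∧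
        ∀ ν, |cenRep (2 * L) ((fun ν (p : ScX d L mv kk hL × ι) => scXi d L mv kk hL ν p.1) ν p₀ - ((k ν).val : ℝ))| < 1) →
      (fun p : ScX d L mv kk hL × ι => scChi d L mv kk hL k p.1) p = 1 :=
    fun μ k => hcubeWindow_of_bumpWindow (2 * L) (fun ν (p : ScX d L mv kk hL × ι) => scXi d L mv kk hL ν p.1) 2
      (fun μ => liftEquiv (scShift d L mv kk hL μ) ι) μ (by norm_num) (hwin2 μ k)
  -- the smallness (n15-c∕119 §3)
  have hq₀ : (β + (β₁ + π / W * β)) * (R * cr) * cr ≤ 1 / 2 := by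
    have hπw : π / W ≤ π := div_le_self pi_pos.le hW1
    have h1 : (β + (β₁ + π / W * β)) * (R * cr) * cr ≤ (β + (β₁ + π * β)) * (R * cr) * cr := by
      have := mul_le_mul_of_nonneg_right hπw hβ0
      exact mul_le_mul_of_nonneg_right (mul_le_mul_of_nonneg_right (by linarith only [this]) (by positivity)) hcr0
    have h2 : (β + (β₁ + π * β)) * (R * cr) * cr = ((β + (β₁ + π * β)) * cr * cr) / (2 * ((β + (β₁ + π * β)) * cr * cr) + 1) := by
      rw [hRdef]; ring
    have h3 : ((β + (β₁ + π * β)) * cr * cr) / (2 * ((β + (β₁ + π * β)) * cr * cr) + 1) ≤ 1 / 2 := by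
      rw [div_le_iff₀ (by positivity)]
      have : 0 ≤ (β + (β₁ + π * β)) * cr * cr := by positivity
      linarith only [this]
    linarith only [h1, h2, h3]
  have hθsm : Nov * cr * (cι2 * (θ₀ * (2 * (β + (β₁ + π * β))) * cr)) ≤ 1 / 4 := by
    have hX : 0 ≤ Nov * cr * (cι2 * (2 * (β + (β₁ + π * β))) * cr) := by positivity
    have e1 : Nov * cr * (cι2 * (θ₀ * (2 * (β + (β₁ + π * β))) * cr)) = θ₀ * (Nov * cr * (cι2 * (2 * (β + (β₁ + π * β))) * cr)) := by ring
    rw [e1, hθ₀def, div_mul_eq_mul_div, one_mul, div_le_iff₀ (by positivity)]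
    linarith only [hX]
  have hθsmF : Nov * cr * (cι2 * (θF * (2 * (β + (β₁ + π * β))) * cr)) ≤ 1 / 4 :=
    (mul_le_mul_of_nonneg_left (mul_le_mul_of_nonneg_left (mul_le_mul_of_nonneg_right (mul_le_mul_of_nonneg_right hθle (by positivity)) hcr0) (by positivity)) (by positivity)).trans hθsm
  have hsmall := cvSmallE (Nov := Nov) (cr := cr) (cι2 := cι2) (cJ := (Fintype.card (Fin (d + 1)) : ℝ)) (β := β) (β₁ := β₁) (w := W) (R := R) (θF := θF) (ε₀ := 0)
    (ε := δm / 2) (E' := 0) (cN₀ := a₀) (D := (d : ℝ) + 1) (κ := 0)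
    hNov0 hcr0 (by positivity) (by positivity) hβ0 hβ₁0 hW1 hR0.le hθF0 (by positivity) le_rfl ha₀.le (by positivity) le_rfl hq₀ hθsmF (by rw [zero_div]) hW0
  -- nonnegative letters for §1's closeness constant (computed before the large rows enter the context)
  have hBw0 : 0 ≤ ((β + (β₁ + (π / W) * β)) * (1 - (β + (β₁ + (π / W) * β)) * (R * cr) * cr)⁻¹) := mul_nonneg (by positivity) (inv_nonneg.2 (by linarith only [hq₀]))
  have hθsl0 : 0 ≤ ((((Fintype.card (Fin (d + 1)) : ℝ) * ((32 * π ^ 2 / W ^ 2) * ((β + (β₁ + (π / W) * β)) * (1 - (β + (β₁ + (π / W) * β)) * (R * cr) * cr)⁻¹) + 2 * ((π / W) * ((β + (β₁ + (π / W) * β)) * (1 - (β + (β₁ + (π / W) * β)) * (R * cr) * cr)⁻¹))) + (0:ℝ) + ((π * (d + 1) / W * 0 + 2 * (π * (d + 1) / W)) * a₀) * ((β + (β₁ + (π / W) * β)) * (1 - (β + (β₁ + (π / W) * β)) * (R * cr) * cr)⁻¹) * cr) + (((π * (d + 1) / W) * (Real.exp 1 * (δm / 2))⁻¹ + 2 *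 ((π * (d + 1) / W) + (π * (d + 1) / W) * (1:ℝ))) * R * ((β + (β₁ + (π / W) * β)) * (1 - (β + (β₁ + (π / W) * β)) * (R * cr) * cr)⁻¹) * cr + R * (π / W) * ((β + (β₁ + (π / W) * β)) * (1 - (β + (β₁ + (π / W) * β)) * (R * cr) * cr)⁻¹) * cr)) + (θF * (1 * ((β + (β₁ + (π / W) * β)) * (1 - (β + (β₁ + (π / W) * β)) * (R * cr) * cr)⁻¹)) * cr)) := by positivity
  have hcι0 : 0 ≤ cι2 := by positivity
  have hBb0 : 0 ≤ (2 * (β + (β₁ + π * β))) := by positivity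
  have hβw0 : 0 ≤ β + (β₁ + (π / W) * β) := by positivity
  have hβwle : β + (β₁ + (π / W) * β) ≤ β + (β₁ + π * β) := by nlinarith only [div_le_self pi_pos.le hW1, hβ0]
  have hE10 : 0 ≤ (Nov * cr * (cι2 * (A₁ + A₂ + 2 * 0))) := by positivity
  have hE20 : 0 ≤ (Nov * cr * (cι2 * ((2 * (β + (β₁ + π * β))) * cr))) := by positivity
  have hRc0 : 0 ≤ rV * (1 + Fintype.card (Fin (d + 1) ⊕ Fin (d + 1))) + RN := by positivity
  have hI0 := inv_nonneg.2 (sub_nonneg.2 (hsmall.2.1.trans (by norm_num : (1 / 2 : ℝ) ≤ 1)))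
  -- 52's hypotheses at the cover
  have htri : Triangle254 (unitTorusGeo L kk (cvM d L mv kk hL)) := triangle254_unitTorusGeo L kk _
  have hd : ∀ a b : Tor (cvM d L mv kk hL), 0 ≤ (unitTorusGeo L kk (cvM d L mv kk hL)).dist a b := unitTorusGeo_dist_nonneg L kk _
  have hd0 : ∀ y : Tor (cvM d L mv kk hL), (unitTorusGeo L kk (cvM d L mv kk hL)).dist y y = 0 := unitTorusGeo_dist_self L kk _
  have hsymm : ∀ y y', (unitTorusGeo L kk (cvM d L mv kk hL)).dist y y' = (unitTorusGeo L kk (cvM d L mv kk hL)).dist y' y := unitTorusGeo_dist_symm L kk _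
  have hrow : RowSum (unitTorusGeo L kk (cvM d L mv kk hL)) (δm / 128) cr :=
    by rw [hcr_def]; exact rowSum_unitTorusGeo L kk _ (by positivity)
  have hσ : 0 ≤ (δm / 128) :=
    by positivity
  have hβ : 0 ≤ β := hC.le
  have hβ₁ : 0 ≤ β₁ := hC.le
  have hct : 0 ≤ (π / W) := div_nonneg pi_pos.le hWpos.le
  have hR : 0 ≤ R := hR0.le
  have hε₀ : 0 ≤ (0:ℝ) := le_rfl
  have hcr : 0 ≤ cr := hcr0
  have hNov : 0 ≤ Nov :=
    by positivity
  have hσρ : (δm / 128) ≤ (δm / 2) :=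
    by linarith only [hδm0]
  have hρ₁V : (δm / 2) ≤ δm :=
    by linarith only [hδm0]
  have hρ₁G : (δm / 2) + (δm / 128) ≤ δm :=
    by linarith only [hδm0]
  have hρ₂ : 0 ≤ (δm / 4) :=
    by positivity
  have hρ₂₁ : (δm / 4) + (δm / 128) ≤ (δm / 2) :=
    by linarith only [hδm0]
  have hρ₂T : (δm / 4) + (δm / 128) ≤ (δm / 2) :=
    by linarith only [hδm0]
  have hρ₃ : 0 ≤ (δm / 8) :=
    by positivity
  have hρ₃₂ : (δm / 8) ≤ (δm / 4) :=
    by linarith only [hδm0]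
  have hρ₃V : (δm / 8) + (δm / 128) ≤ δm - (δm / 2) :=
    by linarith only [hδm0]
  have hρ₃N : (δm / 8) + (δm / 128) ≤ (δm - δm / 2) :=
    by linarith only [hδm0]
  have hσρ₃ : 8 * (δm / 128) ≤ (δm / 8) :=
    by linarith only [hδm0]
  have hε : 0 < (δm / 2) :=
    by positivity
  have hc₁ : 0 ≤ (π / W) := div_nonneg pi_pos.le hWpos.le
  have hc₂ : 0 ≤ (32 * π ^ 2 / W ^ 2) := div_nonneg (by positivity) (pow_nonneg hWpos.le 2)
  have hθW : 0 ≤ (0:ℝ) := le_rfl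
  have hcN : 0 ≤ ((π * (d + 1) / W * 0 + 2 * (π * (d + 1) / W)) * a₀) :=
    by positivity
  have hℓ : 0 ≤ (π * (d + 1) / W) := div_nonneg (by positivity) hWpos.le
  have hω : 0 ≤ (π * (d + 1) / W) := div_nonneg (by positivity) hWpos.le
  have hd₁ : 0 ≤ (1:ℝ) := zero_le_one
  have hSχ : ∀ k x, scChi d L mv kk hL k x ≠ 0 → scBlk d L mv kk hL x ∈ cvSk d L mv kk hL k :=
    fun k x hx => Finset.mem_coe.mpr (blockOf_mem_cubeBlocks_of_inner_ne_zero hM hm₁ hfitI hS0 hx)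
  have hSψ : ∀ k x, scPsi d L mv kk hL k x ≠ 0 → scBlk d L mv kk hL x ∈ cvSk d L mv kk hL k :=
    fun k x hx => Finset.mem_coe.mpr (by by_contra h; exact hx (chiCube_of_not_mem h))
  have hχt : ∀ k x, |scBump d L mv kk hL k x| ≤ 1 := fun k x => abs_bcube_le_one (2 * L) (scXi d L mv kk hL) 2 k x
  have hdχt : ∀ k μ p, |fgrad η⁻¹ (liftEquiv (scShift d L mv kk hL μ) ι) (fun p : ScX d L mv kk hL × ι => scBump d L mv kk hL k p.1) p| ≤ (π / W) :=
    by rw [hηinv]; exact fun k μ p => (abs_fgrad_bcube_le (2 * L) (fun ν (p : ScX d L mv kk hL × ι) => scXi d L mv kk hL ν p.1) 2 (fun μ => liftEquiv (scShift d L mv kk hL μ) ι) hK0 hξS _ k μ p).trans hsW.le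
  have hdχtb : ∀ k μ p, |bgrad η⁻¹ (liftEquiv (scShift d L mv kk hL μ) ι) (fun p : ScX d L mv kk hL × ι => scBump d L mv kk hL k p.1) p| ≤ (π / W) :=
    by rw [hηinv]; exact fun k μ p => (abs_bgrad_bcube_le (2 * L) (fun ν (p : ScX d L mv kk hL × ι) => scXi d L mv kk hL ν p.1) 2 (fun μ => liftEquiv (scShift d L mv kk hL μ) ι) hK0 hξS _ k μ p).trans hsW.le
  have hsub : ∀ k, mulOp (fun p : ScX d L mv kk hL × ι => scBump d L mv kk hL k p.1) ∘ₗ mulOp (fun p : ScX d L mv kk hL × ι => scChi d L mv kk hL k p.1) = mulOp (fun p : ScX d L mv kk hL × ι => scBump d L mv kk hL k p.1) :=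
    fun k => bcube_cut (2 * L) (fun ν (p : ScX d L mv kk hL × ι) => scXi d L mv kk hL ν p.1) 2 (fun μ => liftEquiv (scShift d L mv kk hL μ) ι) 0 (hwin2 0 k)
  have hχ : ∀ k, mulOp (fun p : ScX d L mv kk hL × ι => scChi d L mv kk hL k p.1) ∘ₗ mulOp (fun p : ScX d L mv kk hL × ι => scBump d L mv kk hL k p.1) = mulOp (fun p : ScX d L mv kk hL × ι => scBump d L mv kk hL k p.1) :=
    fun k => cut_bcube (2 * L) (fun ν (p : ScX d L mv kk hL × ι) => scXi d L mv kk hL ν p.1) 2 (fun μ => liftEquiv (scShift d L mv kk hL μ) ι) 0 (hwin2 0 k)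
  have hs : ∀ k μ, mulOp ((fun p : ScX d L mv kk hL × ι => scBump d L mv kk hL k p.1) ∘ (liftEquiv (scShift d L mv kk hL μ) ι)) ∘ₗ mulOp (fun p : ScX d L mv kk hL × ι => scChi d L mv kk hL k p.1) = mulOp ((fun p : ScX d L mv kk hL × ι => scBump d L mv kk hL k p.1) ∘ (liftEquiv (scShift d L mv kk hL μ) ι)) :=
    fun k μ => bcube_comp_shift_cut (2 * L) (fun ν (p : ScX d L mv kk hL × ι) => scXi d L mv kk hL ν p.1) 2 (fun μ => liftEquiv (scShift d L mv kk hL μ) ι) μ (hwin2 μ k)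
  have hsb : ∀ k μ, mulOp ((fun p : ScX d L mv kk hL × ι => scBump d L mv kk hL k p.1) ∘ (liftEquiv (scShift d L mv kk hL μ) ι).symm) ∘ₗ mulOp (fun p : ScX d L mv kk hL × ι => scChi d L mv kk hL k p.1) = mulOp ((fun p : ScX d L mv kk hL × ι => scBump d L mv kk hL k p.1) ∘ (liftEquiv (scShift d L mv kk hL μ) ι).symm) :=
    fun k μ => bcube_comp_shift_symm_cut (2 * L) (fun ν (p : ScX d L mv kk hL × ι) => scXi d L mv kk hL ν p.1) 2 (fun μ => liftEquiv (scShift d L mv kk hL μ) ι) μ (hwin2 μ k)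
  have hdd : ∀ k μ, mulOp (fgrad η⁻¹ (liftEquiv (scShift d L mv kk hL μ) ι) (fun p : ScX d L mv kk hL × ι => scBump d L mv kk hL k p.1)) ∘ₗ mulOp (fun p : ScX d L mv kk hL × ι => scChi d L mv kk hL k p.1) = mulOp (fgrad η⁻¹ (liftEquiv (scShift d L mv kk hL μ) ι) (fun p : ScX d L mv kk hL × ι => scBump d L mv kk hL k p.1)) :=
    fun k μ => fgrad_bcube_cut (2 * L) (fun ν (p : ScX d L mv kk hL × ι) => scXi d L mv kk hL ν p.1) 2 (fun μ => liftEquiv (scShift d L mv kk hL μ) ι) μ η⁻¹ (hwin2 μ k)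
  have hddb : ∀ k μ, mulOp (bgrad η⁻¹ (liftEquiv (scShift d L mv kk hL μ) ι) (fun p : ScX d L mv kk hL × ι => scBump d L mv kk hL k p.1)) ∘ₗ mulOp (fun p : ScX d L mv kk hL × ι => scChi d L mv kk hL k p.1) = mulOp (bgrad η⁻¹ (liftEquiv (scShift d L mv kk hL μ) ι) (fun p : ScX d L mv kk hL × ι => scBump d L mv kk hL k p.1)) :=
    fun k μ => bgrad_bcube_cut (2 * L) (fun ν (p : ScX d L mv kk hL × ι) => scXi d L mv kk hL ν p.1) 2 (fun μ => liftEquiv (scShift d L mv kk hL μ) ι) μ η⁻¹ (hwin2 μ k)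
  have hs' : ∀ k μ, mulOp (fun p : ScX d L mv kk hL × ι => scChi d L mv kk hL k p.1) ∘ₗ mulOp ((fun p : ScX d L mv kk hL × ι => scBump d L mv kk hL k p.1) ∘ (liftEquiv (scShift d L mv kk hL μ) ι)) = mulOp ((fun p : ScX d L mv kk hL × ι => scBump d L mv kk hL k p.1) ∘ (liftEquiv (scShift d L mv kk hL μ) ι)) :=
    fun k μ => cut_bcube_comp_shift (2 * L) (fun ν (p : ScX d L mv kk hL × ι) => scXi d L mv kk hL ν p.1) 2 (fun μ => liftEquiv (scShift d L mv kk hL μ) ι) μ (hwin2 μ k)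
  have hsb' : ∀ k μ, mulOp (fun p : ScX d L mv kk hL × ι => scChi d L mv kk hL k p.1) ∘ₗ mulOp ((fun p : ScX d L mv kk hL × ι => scBump d L mv kk hL k p.1) ∘ (liftEquiv (scShift d L mv kk hL μ) ι).symm) = mulOp ((fun p : ScX d L mv kk hL × ι => scBump d L mv kk hL k p.1) ∘ (liftEquiv (scShift d L mv kk hL μ) ι).symm) :=
    fun k μ => cut_bcube_comp_shift_symm (2 * L) (fun ν (p : ScX d L mv kk hL × ι) => scXi d L mv kk hL ν p.1) 2 (fun μ => liftEquiv (scShift d L mv kk hL μ) ι) μ (hwin2 μ k)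
  have hdd' : ∀ k μ, mulOp (fun p : ScX d L mv kk hL × ι => scChi d L mv kk hL k p.1) ∘ₗ mulOp (fgrad η⁻¹ (liftEquiv (scShift d L mv kk hL μ) ι) (fun p : ScX d L mv kk hL × ι => scBump d L mv kk hL k p.1)) = mulOp (fgrad η⁻¹ (liftEquiv (scShift d L mv kk hL μ) ι) (fun p : ScX d L mv kk hL × ι => scBump d L mv kk hL k p.1)) :=
    fun k μ => cut_fgrad_bcube (2 * L) (fun ν (p : ScX d L mv kk hL × ι) => scXi d L mv kk hL ν p.1) 2 (fun μ => liftEquiv (scShift d L mv kk hL μ) ι) μ η⁻¹ (hwin2 μ k)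
  have hddb' : ∀ k μ, mulOp (fun p : ScX d L mv kk hL × ι => scChi d L mv kk hL k p.1) ∘ₗ mulOp (bgrad η⁻¹ (liftEquiv (scShift d L mv kk hL μ) ι) (fun p : ScX d L mv kk hL × ι => scBump d L mv kk hL k p.1)) = mulOp (bgrad η⁻¹ (liftEquiv (scShift d L mv kk hL μ) ι) (fun p : ScX d L mv kk hL × ι => scBump d L mv kk hL k p.1)) :=
    fun k μ => cut_bgrad_bcube (2 * L) (fun ν (p : ScX d L mv kk hL × ι) => scXi d L mv kk hL ν p.1) 2 (fun μ => liftEquiv (scShift d L mv kk hL μ) ι) μ η⁻¹ (hwin2 μ k)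
  have hNψ : ∀ k, (scCube d L mv kk hL (aK a₀ (L : ℝ) kk * (((L ^ kk : ℕ) : ℝ)) ^ (d + 1)) ι k) ∘ₗ mulOp (fun p : ScX d L mv kk hL × ι => scPsi d L mv kk hL k p.1) = (scCube d L mv kk hL (aK a₀ (L : ℝ) kk * (((L ^ kk : ℕ) : ℝ)) ^ (d + 1)) ι k) :=
    fun k => scCube_comp_mulOp_scPsi ι _ k
  have hcut : ∀ k, HasMaj (ScNorm d L mv kk hL ι) (ScNorm d L mv kk hL ι) (mulOp (fun p : ScX d L mv kk hL × ι => scChi d L mv kk hL k p.1) ∘ₗ (scCube d L mv kk hL (aK a₀ (L : ℝ) kk * (((L ^ kk : ℕ) : ℝ)) ^ (d + 1)) ι k)) (fun y y' => ind (g := unitTorusGeo L kk (cvM d L mv kk hL)) (cvSk d L mv kk hL k) y * ind (g := unitTorusGeo L kk (cvM d L mv kk hL)) (cvSk d L mv kk hL k) y' * (β * Real.exp (-(δm * (unitTorusGeo L kk (cvM d L mv kk hL)).dist y y')))) :=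
    fun k => hasMaj_cut_scCube ι hM hm₁ hfitI hS0 hC.le hG0 k
  have hcutF : ∀ k μ, HasMaj (ScNorm d L mv kk hL ι) (ScNorm d L mv kk hL ι) (mulOp (fun p : ScX d L mv kk hL × ι => scChi d L mv kk hL k p.1) ∘ₗ (fgrad η⁻¹ (liftEquiv (scShift d L mv kk hL μ) ι) ∘ₗ (scCube d L mv kk hL (aK a₀ (L : ℝ) kk * (((L ^ kk : ℕ) : ℝ)) ^ (d + 1)) ι k))) (fun y y' => ind (g := unitTorusGeo L kk (cvM d L mv kk hL)) (cvSk d L mv kk hL k) y * ind (g := unitTorusGeo L kk (cvM d L mv kk hL)) (cvSk d L mv kk hL k) y' * (β₁ * Real.exp (-(δm * (unitTorusGeo L kk (cvM d L mv kk hL)).dist y y')))) :=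
    fun k μ => hasMaj_cutF_scCube ι hM hm₁ hfitI hS0 hC μ hGF k
  have hcutB : ∀ k μ, HasMaj (ScNorm d L mv kk hL ι) (ScNorm d L mv kk hL ι) (mulOp (fun p : ScX d L mv kk hL × ι => scChi d L mv kk hL k p.1) ∘ₗ (bgrad η⁻¹ (liftEquiv (scShift d L mv kk hL μ) ι) ∘ₗ (scCube d L mv kk hL (aK a₀ (L : ℝ) kk * (((L ^ kk : ℕ) : ℝ)) ^ (d + 1)) ι k))) (fun y y' => ind (g := unitTorusGeo L kk (cvM d L mv kk hL)) (cvSk d L mv kk hL k) y * ind (g := unitTorusGeo L kk (cvM d L mv kk hL)) (cvSk d L mv kk hL k) y' * (β₁ * Real.exp (-(δm * (unitTorusGeo L kk (cvM d L mv kk hL)).dist y y')))) :=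
    fun k μ => hasMaj_cutB_scCube ι hM hm₁ hfitI hS0 hC μ hGB k
  have hhabs : ∀ k x, |scH d L mv kk hL k x| ≤ 1 := fun k x => abs_hcube_le_one (2 * L) (scXi d L mv kk hL) k x
  have hhcut : ∀ k, mulOp (fun p : ScX d L mv kk hL × ι => scH d L mv kk hL k p.1) ∘ₗ mulOp (fun p : ScX d L mv kk hL × ι => scChi d L mv kk hL k p.1) = mulOp (fun p : ScX d L mv kk hL × ι => scH d L mv kk hL k p.1) :=
    fun k => hcube_cut (2 * L) (fun ν (p : ScX d L mv kk hL × ι) => scXi d L mv kk hL ν p.1) (fun μ => liftEquiv (scShift d L mv kk hL μ) ι) 0 (hwin 0 k)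
  have hh1 : ∀ k μ p, |fgrad η⁻¹ (liftEquiv (scShift d L mv kk hL μ) ι) (fun p : ScX d L mv kk hL × ι => scH d L mv kk hL k p.1) p| ≤ (π / W) :=
    by rw [hηinv]; exact fun k μ p => (abs_fgrad_hcube_le (2 * L) (fun ν (p : ScX d L mv kk hL × ι) => scXi d L mv kk hL ν p.1) (fun μ => liftEquiv (scShift d L mv kk hL μ) ι) hK0 hξS _ k μ p).trans hsW.le
  have hh1b : ∀ k μ p, |bgrad η⁻¹ (liftEquiv (scShift d L mv kk hL μ) ι) (fun p : ScX d L mv kk hL × ι => scH d L mv kk hL k p.1) p| ≤ (π / W) :=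
    by rw [hηinv]; exact fun k μ p => (abs_bgrad_hcube_le (2 * L) (fun ν (p : ScX d L mv kk hL × ι) => scXi d L mv kk hL ν p.1) (fun μ => liftEquiv (scShift d L mv kk hL μ) ι) hK0 hξS _ k μ p).trans hsW.le
  have hh2 : ∀ k μ p, |fgradAdj η⁻¹ (liftEquiv (scShift d L mv kk hL μ) ι) (fgrad η⁻¹ (liftEquiv (scShift d L mv kk hL μ) ι) (fun p : ScX d L mv kk hL × ι => scH d L mv kk hL k p.1)) p| ≤ (32 * π ^ 2 / W ^ 2) :=
    by rw [hηinv]; exact fun k μ p => (abs_fgradAdj_fgrad_hcube_le (2 * L) (fun ν (p : ScX d L mv kk hL × ι) => scXi d L mv kk hL ν p.1) (fun μ => liftEquiv (scShift d L mv kk hL μ) ι) hK2 hξS hs0 hs1 _ k μ p).trans hsW2.le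
  have hLip : ∀ k y y', |coverHb (cvM d L mv kk hL) (L ^ kk) (L ^ mv) L k y - coverHb (cvM d L mv kk hL) (L ^ kk) (L ^ mv) L k y'| ≤ (π * (d + 1) / W) * (unitTorusGeo L kk (cvM d L mv kk hL)).dist y y' :=
    fun k y y' => abs_coverHb_sub_le hM hw k y y'
  have hrh : ∀ k (p : ScX d L mv kk hL × ι), |scH d L mv kk hL k p.1 - coverHb (cvM d L mv kk hL) (L ^ kk) (L ^ mv) L k (liftBlk (scBlk d L mv kk hL) ι p)| ≤ (π * (d + 1) / W) :=
    fun k p => abs_coverH_sub_coverHb_le hM hw k (p.1, 0)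
  have hstep : ∀ μ x, (unitTorusGeo L kk (cvM d L mv kk hL)).dist (scBlk d L mv kk hL (scShift d L mv kk hL μ x)) (scBlk d L mv kk hL x) ≤ (1:ℝ) :=
    fun μ x => tdistT_scBlk_scShift_le μ x
  have hN : ∀ a, ∑ k, ind (g := unitTorusGeo L kk (cvM d L mv kk hL)) (cvSk d L mv kk hL k) a ≤ Nov :=
    fun y => sum_ind_cubeBlocks_le (M := cvM d L mv kk hL) (w := L ^ mv) (q := L) (m₀ := coverMargin L mv) L kk y
  have hT : ∀ k, HasMaj (ScNorm d L mv kk hL ι) (ScNorm d L mv kk hL ι) ((-(mulOp (fun p : ScX d L mv kk hL × ι => scH d L mv kk hL k p.1) ∘ₗ (scQQ d L mv kk hL (aK a₀ (L : ℝ) kk * (((L ^ kk : ℕ) : ℝ)) ^ (d + 1)) ι) ∘ₗ mulOp (1 - fun p : ScX d L mv kk hL × ι => scBump d L mv kk hL k p.1))) ∘ₗ (scCube d L mv kk hL (aK a₀ (L : ℝ) kk * (((L ^ kk : ℕ) : ℝ)) ^ (d + 1)) ι k)) (fun y y' => ind (g := unitTorusGeo L kk (cvM d L mv kk hL)) (cvSk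 d L mv kk hL k) y * ind (g := unitTorusGeo L kk (cvM d L mv kk hL)) (cvSk d L mv kk hL k) y' * ((0:ℝ) * Real.exp (-((δm / 2) * (unitTorusGeo L kk (cvM d L mv kk hL)).dist y y')))) := fun k => by
    rw [mulOp_scH_comp_scQQ_comp_one_sub_scBump ι hw _ k, neg_zero, LinearMap.zero_comp]
    exact (hasMaj_zero _ _).mono fun y y' => mul_nonneg (mul_nonneg (ind_nonneg _ _) (ind_nonneg _ _)) (by positivity)
  have hq : (β + (β₁ + (π / W) * β)) * (R * cr) * cr < 1 := hq₀.trans_lt (by norm_num)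
  have hKN : ∀ k, HasMaj (ScNorm d L mv kk hL ι) (ScNorm d L mv kk hL ι) (commOp (scQQ d L mv kk hL (aK a₀ (L : ℝ) kk * (((L ^ kk : ℕ) : ℝ)) ^ (d + 1)) ι) (fun p : ScX d L mv kk hL × ι => scH d L mv kk hL k p.1)) (fun y y' => ((π * (d + 1) / W * 0 + 2 * (π * (d + 1) / W)) * a₀) * Real.exp (-((δm - δm / 2) * (unitTorusGeo L kk (cvM d L mv kk hL)).dist y y'))) :=
    fun k => (hasMaj_commOp_scQQ ι hM hw _ (δm - δm / 2) k).mono fun y y' => mul_le_mul_of_nonneg_right hcNle (Real.exp_nonneg _)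
  have hρF : (δm / 8) + (δm / 128) ≤ δm :=
    by linarith only [hδm0]
  have hχ1 : ∀ k x, |scChi d L mv kk hL k x| ≤ 1 := fun k x => abs_chiCube_le_one _ _
  have hψχ : ∀ k, mulOp (fun p : ScX d L mv kk hL × ι => scPsi d L mv kk hL k p.1) ∘ₗ mulOp (fun p : ScX d L mv kk hL × ι => scChi d L mv kk hL k p.1) = mulOp (fun p : ScX d L mv kk hL × ι => scChi d L mv kk hL k p.1) :=
    fun k => mulOp_comp_mulOp_of_support_left fun p hp => chiCube_eq_one_of_inner_ne_zero hM hm₁ hfitI hS0 hp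
  have hhψ : ∀ k, mulOp (fun p : ScX d L mv kk hL × ι => scH d L mv kk hL k p.1) ∘ₗ mulOp (fun p : ScX d L mv kk hL × ι => scPsi d L mv kk hL k p.1) = mulOp (fun p : ScX d L mv kk hL × ι => scH d L mv kk hL k p.1) :=
    fun k => mulOp_scH_comp_mulOp_scPsi ι hM hw hfit k
  have hχh : ∀ k, mulOp (fun p : ScX d L mv kk hL × ι => scChi d L mv kk hL k p.1) ∘ₗ mulOp (fun p : ScX d L mv kk hL × ι => scH d L mv kk hL k p.1) = mulOp (fun p : ScX d L mv kk hL × ι => scH d L mv kk hL k p.1) :=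
    fun k => cut_hcube (2 * L) (fun ν (p : ScX d L mv kk hL × ι) => scXi d L mv kk hL ν p.1) 2 (fun μ => liftEquiv (scShift d L mv kk hL μ) ι) 0 (by norm_num) (hwin2 0 k)
  have hhs' : ∀ k μ, mulOp (fun p : ScX d L mv kk hL × ι => scChi d L mv kk hL k p.1) ∘ₗ mulOp ((fun p : ScX d L mv kk hL × ι => scH d L mv kk hL k p.1) ∘ (liftEquiv (scShift d L mv kk hL μ) ι)) = mulOp ((fun p : ScX d L mv kk hL × ι => scH d L mv kk hL k p.1) ∘ (liftEquiv (scShift d L mv kk hL μ) ι)) :=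
    fun k μ => cut_hcube_comp_shift (2 * L) (fun ν (p : ScX d L mv kk hL × ι) => scXi d L mv kk hL ν p.1) 2 (fun μ => liftEquiv (scShift d L mv kk hL μ) ι) μ (by norm_num) (hwin2 μ k)
  have hhsb' : ∀ k μ, mulOp (fun p : ScX d L mv kk hL × ι => scChi d L mv kk hL k p.1) ∘ₗ mulOp ((fun p : ScX d L mv kk hL × ι => scH d L mv kk hL k p.1) ∘ (liftEquiv (scShift d L mv kk hL μ) ι).symm) = mulOp ((fun p : ScX d L mv kk hL × ι => scH d L mv kk hL k p.1) ∘ (liftEquiv (scShift d L mv kk hL μ) ι).symm) :=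
    fun k μ => cut_hcube_comp_shift_symm (2 * L) (fun ν (p : ScX d L mv kk hL × ι) => scXi d L mv kk hL ν p.1) 2 (fun μ => liftEquiv (scShift d L mv kk hL μ) ι) μ (by norm_num) (hwin2 μ k)
  have hhdd' : ∀ k μ, mulOp (fun p : ScX d L mv kk hL × ι => scChi d L mv kk hL k p.1) ∘ₗ mulOp (fgrad η⁻¹ (liftEquiv (scShift d L mv kk hL μ) ι) (fun p : ScX d L mv kk hL × ι => scH d L mv kk hL k p.1)) = mulOp (fgrad η⁻¹ (liftEquiv (scShift d L mv kk hL μ) ι) (fun p : ScX d L mv kk hL × ι => scH d L mv kk hL k p.1)) :=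
    fun k μ => cut_fgrad_hcube (2 * L) (fun ν (p : ScX d L mv kk hL × ι) => scXi d L mv kk hL ν p.1) 2 (fun μ => liftEquiv (scShift d L mv kk hL μ) ι) μ (by norm_num) η⁻¹ (hwin2 μ k)
  have hhddb' : ∀ k μ, mulOp (fun p : ScX d L mv kk hL × ι => scChi d L mv kk hL k p.1) ∘ₗ mulOp (bgrad η⁻¹ (liftEquiv (scShift d L mv kk hL μ) ι) (fun p : ScX d L mv kk hL × ι => scH d L mv kk hL k p.1)) = mulOp (bgrad η⁻¹ (liftEquiv (scShift d L mv kk hL μ) ι) (fun p : ScX d L mv kk hL × ι => scH d L mv kk hL k p.1)) :=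
    fun k μ => cut_bgrad_hcube (2 * L) (fun ν (p : ScX d L mv kk hL × ι) => scXi d L mv kk hL ν p.1) 2 (fun μ => liftEquiv (scShift d L mv kk hL μ) ι) μ (by norm_num) η⁻¹ (hwin2 μ k)
  have hq' : Nov * ((Fintype.card ι : ℝ) ^ 2 * ((((Fintype.card (Fin (d + 1)) : ℝ) * ((32 * π ^ 2 / W ^ 2) * ((β + (β₁ + (π / W) * β)) * (1 - (β + (β₁ + (π / W) * β)) * (R * cr) * cr)⁻¹) + 2 * ((π / W) * ((β + (β₁ + (π / W) * β)) * (1 - (β + (β₁ + (π / W) * β)) * (R * cr) * cr)⁻¹))) + (0:ℝ) + ((π * (d + 1) / W * 0 + 2 * (π * (d + 1) / W)) * a₀) * ((β + (β₁ + (π / W) * β)) * (1 - (β + (β₁ + (π / W) * β)) * (R * cr) * cr)⁻¹) * cr)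
          + (((π * (d + 1) / W) * (Real.exp 1 * (δm / 2))⁻¹ + 2 * ((π * (d + 1) / W) + (π * (d + 1) / W) * (1:ℝ))) * R * ((β + (β₁ + (π / W) * β)) * (1 - (β + (β₁ + (π / W) * β)) * (R * cr) * cr)⁻¹) * cr + R * (π / W) * ((β + (β₁ + (π / W) * β)) * (1 - (β + (β₁ + (π / W) * β)) * (R * cr) * cr)⁻¹) * cr)) + (θF * (1 * ((β + (β₁ + (π / W) * β)) * (1 - (β + (β₁ + (π / W) * β)) * (R * cr) * cr)⁻¹)) * cr)) + (Fintype.card ι : ℝ) ^ 2 * (((0:ℝ) * (1 - (β + (β₁ + (π / W) * β)) * (R * cr) * cr)⁻¹) + 0)) * cr < 1 :=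
    hsmall.2.1.trans_lt (by norm_num)
  -- §1: `E ≤ e₁W⁻¹ + e₂θ_F`
  have hE1 : _ ≤ (Nov * cr * (cι2 * (A₁ + A₂ + 2 * 0))) * W⁻¹ + (Nov * cr * (cι2 * ((2 * (β + (β₁ + π * β))) * cr))) * θF :=
    hsmall.1.trans (le_of_eq (by rw [div_eq_mul_inv, div_eq_mul_inv, div_eq_mul_inv]; ring))
  have key := uN_hasMaj_comp_glueInv_sub_smoothCutDressed_localGauges_close (X := ScX d L mv kk hL) (ι := ι) (J := Fin (d + 1)) (K := Fin (d + 1) → ZMod (2 * L))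
    (g := unitTorusGeo L kk (cvM d L mv kk hL)) (scBlk d L mv kk hL) (scShift d L mv kk hL)
    (N := scCube d L mv kk hL (aK a₀ (L : ℝ) kk * (((L ^ kk : ℕ) : ℝ)) ^ (d + 1)) ι) (NL := scQQ d L mv kk hL (aK a₀ (L : ℝ) kk * (((L ^ kk : ℕ) : ℝ)) ^ (d + 1)) ι)
    (χX := scChi d L mv kk hL) (χtX := scBump d L mv kk hL) (ψX := scPsi d L mv kk hL)
    (hX := scH d L mv kk hL) (Sk := cvSk d L mv kk hL) (hb := coverHb (cvM d L mv kk hL) (L ^ kk) (L ^ mv) L)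
    e (η := η) Far Z dZ (htri := htri) (hd := hd) (hd0 := hd0) (hsymm := hsymm) (hdZ := hdZ) (hdZ0 := hdZ0) (hrow := hrow) (hσ := hσ) (hβ := hβ) (hβ₁ := hβ₁) (hct := hct) (hR := hR) (hε₀ := hε₀) (hcr := hcr) (hNov := hNov) (hσρ := hσρ) (hρ₁V := hρ₁V) (hρ₁G := hρ₁G) (hρ₂ := hρ₂) (hρ₂₁ := hρ₂₁) (hρ₂T := hρ₂T) (hρ₃ := hρ₃) (hρ₃₂ := hρ₃₂) (hρ₃V := hρ₃V) (hρ₃N := hρ₃N) (hσρ₃ := hσρ₃) (hε := hε) (hc₁ := hc₁) (hc₂ := hc₂) (hθW := hθW) (hcN := hcN) (hℓ := hℓ) (hω := hω) (hd₁ := hd₁) (hSχ := hSχ) (hSψ := hSψ) (hχt := hχt) (hdχt := hdχt) (hdχtb := hdχtb) (hsub := hsub) (hχ := hχ) (hs := hs) (hsb := hsb) (hdd := hdd) (hddb := hddb) (hs' := hs') (hsb' := hsb') (hdd' := hdd') (hddb' := hddb') (hNψ := hNψ) (hcut := hcut) (hcutF := hcutF) (hcutB := hcutB) (hhabs := hhabs)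 (hhcut := hhcut) (hh1 := hh1) (hh1b := hh1b) (hh2 := hh2) (hLip := hLip) (hrh := hrh) (hstep := hstep) (hN := hN) (hT := hT) (hq := hq) (hKN := hKN) (he := he) (hu := hu) (hrV := hrV) (hRN := hRN) (hθF := hθF0) (hρF := hρF) (hRle := hRle) (hP := hP) (hχ1 := hχ1) (hψχ := hψχ) (hCloc := hCloc) (hAloc := hAloc) (hNVcut := hNVcut) (hfarN := hfarN) (hhψ := hhψ) (hχh := hχh) (hhs' := hhs') (hhsb' := hhsb') (hhdd' := hhdd') (hhddb' := hhddb') (hq' := hq') (u₂ := u₂) (U₂ := U₂) (P₂ := P₂) (NV₂ := NV₂) (hu₂ := hu₂) (hP₂ := hP₂) (hCloc₂ := hCloc₂) (hAloc₂ := hAloc₂) (hNVcut₂ := hNVcut₂) (hfarN₂ := hfarN₂) (hZ := hZ) (huu := huu)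
    (jj := jj) (hcs := hcs) (hcd := hcd) (hrP := hrP) (hρP := by linarith only [hδm0]) (hvg' := hvg') (hDcov := by rw [hηinv]; exact hDcov) (hDleib := hDleib) (hhs := hhs) (hdh := hdh) (hPsp := hPsp) (hPfar := hPfar)
    (hvg₂' := hvg₂') (hDcov₂ := by rw [hηinv]; exact hDcov₂) (hDleib₂ := hDleib₂) (hPsp₂ := hPsp₂) (hPfar₂ := hPfar₂) (hvv := hvv)
  refine key.mono fun y y' => ?_
  rw [show (δm / 8) / 4 - 2 * (δm / 128) = δm / 64 by ring, show (δm / 8) / 4 - (δm / 128) = 3 * δm / 128 by ring]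
  refine mul_le_mul_of_nonneg_right ?_ (Real.exp_nonneg _)
  exact closeMajJet_le hNov0 hcι0 hBw0 hsmall.2.2.1 hBb0 hI0 hsmall.2.2.2 hcr0 hβw0 hβwle hθsl0 (by simp) rfl hsmall.2.1 (Real.exp_nonneg _) hRc0 hE10 hE20 hWpos hθF0 hE1 hcs hcd hrP

end Knit

end Summit.QuantumFields.YangMills.BalabanUVNodes.N15.Gluing

end
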